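import Literature.Analysis.FluidPDE.TypeIAncientMild
import Literature.Analysis.FluidPDE.KNSSProp41MildHolds
import Literature.Analysis.FluidPDE.KNSSMildRegularityTime
import Literature.Analysis.FluidPDE.OseenHeatKernelBridge
import Literature.Analysis.FluidPDE.NSBoundedMildSmoothing
import Literature.Analysis.FluidPDE.KNSSMildRegularity
import Literature.Analysis.FluidPDE.TaoQuantitativeTotalSpeed
import Literature.Analysis.FluidPDE.KNSSTypeIRateCompactnessProofs
import HarnessLib

/-!
# Uniform regularity of continuous Type-I Oseen-mild ancient fields (route `SqueezeCycle`,
# item `ExtremalElementExists`, stmt-NavierStokesRegularity-11611)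

Helper file for the compactness of the Type-I model class `𝒦_C` of route `SqueezeCycle`.
A field `u : ℝ → ℝ³ → ℝ³` which is jointly continuous on the open slab `(-∞, 0) × ℝ³`, has weakly
divergence-free slices, satisfies the Oseen integral equation
`u t x = e^{(t-s)Δ}u(s)(x) - B¹_s(u,u)(t)(x)` for all `s < t < 0`, and obeys the Type-I bound
`‖u(t,x)‖ ≤ C/√(-t)`, is — after a time shift and a clamp — a restarted bounded mild field of
KNSS 2009, §4 on every window `(a, b)`, `a < b < 0` (`IsKNSSDriftMild`). Consequently
(KNSS 2009, Prop. 4.1 in the tree's rendering `KNSS2009_prop41_mild_holds`,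
`KNSSBootstrap.exists_norm_iteratedFDeriv_slice_le`, `KNSSBootstrap.exists_lipschitz_time_iteratedFDeriv`):

* it is jointly `C^∞` on the slab, divergence free, hence a member of `IsTypeIAncientMild C`
  (`isTypeIAncientMild_of_continuous_oseenMild`);
* for every order `k`, window `a < b < 0` and margin `δ > 0` there are constants, depending on
  `k, a, b, δ, C` only, bounding `‖Dᵏ u(t)(x)‖` on `[a + δ, b) × ℝ³` and the time-Lipschitz
  modulus of `Dᵏu(·)(x)` there, uniformly over all such fields with the same constant `C`
  (`exists_norm_iteratedFDeriv_le_of_typeI`, `exists_lipschitz_time_of_typeI`).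
-/

noncomputable section

open MeasureTheory Set Function Filter TopologicalSpace Metric
open scoped Topology NNReal ENNReal

namespace Summit.NavierStokesRegularity.NavierStokesRegularity.Theorems

open Literature.Analysis Literature.Analysis.FluidPDE

/-! ### The clamped, shifted window field -/

/-- The clamp `τ ↦ max a (min (τ + a) b)` is continuous, takes values in `[a, b]` (`a ≤ b`) and is
the shift `τ + a` for `τ ∈ [0, b - a]`. [folklore] -/
theorem clampShift_facts {a b : ℝ} (hab : a ≤ b) :
    Continuous (fun τ : ℝ => max a (min (τ + a) b)) ∧
      (∀ τ : ℝ, max a (min (τ + a) b) ∈ Icc a b) ∧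
      ∀ τ ∈ Icc 0 (b - a), max a (min (τ + a) b) = τ + a :=
  ⟨continuous_const.max ((continuous_id.add continuous_const).min continuous_const), fun τ =>
    ⟨le_max_left _ _, max_le hab (min_le_right _ _)⟩, fun τ hτ => by
    rw [min_eq_left (by linarith [hτ.2]), max_eq_right (by linarith [hτ.1])]⟩

/-- The Type-I constant of a field satisfying the Type-I bound at some negative time is
nonnegative. [folklore] -/
theorem typeI_const_nonneg {C : ℝ} {u : ℝ → EuclideanSpace ℝ (Fin 3) → EuclideanSpace ℝ (Fin 3)}
    (hI : HasTypeITimeDecay C u) : 0 ≤ C := by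
  have h := hI (-1) (by norm_num) 0
  rw [neg_neg, Real.sqrt_one, div_one] at h
  exact (norm_nonneg _).trans h

section Window

variable {C : ℝ} {u : ℝ → EuclideanSpace ℝ (Fin 3) → EuclideanSpace ℝ (Fin 3)}

/-- **A continuous Type-I Oseen-mild ancient field is a restarted bounded mild field on every
window** (KNSS 2009, §4 (i)): for `a < b < 0` the clamped shift
`V τ x = u (max a (min (τ + a) b)) x` satisfies `IsKNSSDriftMild (b - a) (C/√(-b)) V 0` — jointly
measurable (continuous), bounded by `C/√(-b)` on the window, weakly divergence free, and
`V(t) = e^{(t−s)Δ}V(s) − ∫ₛᵗ e^{(t−σ)Δ}P∇·(V⊗V)` for `0 < s < t < b - a`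
(`driftDuhamel_zero_eq_oseenDuhamel`, `oseenDuhamel_translate`). [cite: KochNadirashviliSereginSverak2009, §4 (i) (arXiv:0709.3599v1 p. 8)] -/
theorem isKNSSDriftMild_window (hc : ContinuousOn (uncurry u) (Iio 0 ×ˢ univ))
    (hdiv : ∀ t < 0, IsWeaklyDivFree (u t))
    (hmild : ∀ s t : ℝ, s < t → t < 0 → ∀ x,
      u t x = UnboundedOperators.heatExtension (u s) (t - s) x - oseenDuhamel 1 s u u t x)
    (hI : HasTypeITimeDecay C u) {a b : ℝ} (hab : a < b) (hb : b < 0) :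
    IsKNSSDriftMild (b - a) (C / Real.sqrt (-b)) (fun τ x => u (max a (min (τ + a) b)) x) 0 := by
  obtain ⟨hκc, hκmem, hκid⟩ := clampShift_facts hab.le
  have hC : 0 ≤ C := typeI_const_nonneg hI
  have hN0 : 0 ≤ C / Real.sqrt (-b) := by positivity
  have hκneg : ∀ τ, max a (min (τ + a) b) < 0 := fun τ => (hκmem τ).2.trans_lt hb
  have hcont : Continuous (uncurry fun τ x => u (max a (min (τ + a) b)) x) := by
    have hmap : Continuous fun p : ℝ × EuclideanSpace ℝ (Fin 3) =>
        (max a (min (p.1 + a) b), p.2) :=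
      (hκc.comp continuous_fst).prodMk continuous_snd
    have hinto : ∀ p : ℝ × EuclideanSpace ℝ (Fin 3),
        (max a (min (p.1 + a) b), p.2) ∈ Iio (0 : ℝ) ×ˢ (univ : Set (EuclideanSpace ℝ (Fin 3))) :=
      fun p => ⟨hκneg p.1, mem_univ _⟩
    exact (hc.comp_continuous hmap hinto).congr fun p => rfl
  have hslice : ∀ t < 0, Continuous (u t) := fun t ht =>
    hc.comp_continuous (Continuous.prodMk_right t) fun x => ⟨ht, mem_univ x⟩
  have hbd : ∀ τ ∈ Ioo 0 (b - a), ∀ x, ‖u (max a (min (τ + a) b)) x‖ ≤ C / Real.sqrt (-b) := by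
    intro τ hτ x
    rw [hκid τ ⟨hτ.1.le, hτ.2.le⟩]
    have hτa : τ + a < 0 := by linarith [hτ.2]
    exact (hI (τ + a) hτa x).trans (div_sqrt_neg_le hC (neg_pos.2 hb) (by linarith [hτ.2]))
  refine IsKNSSDriftMild.mk measurable_const (fun t => by simpa using hN0) hcont.measurable hbd
    ?_ ?_
  · exact Eventually.of_forall fun τ => hdiv _ (hκneg τ)
  · intro s t hs hst htT x
    have hsid : max a (min (s + a) b) = s + a := hκid s ⟨hs.le, (hst.trans htT).le⟩
    have htid : max a (min (t + a) b) = t + a := hκid t ⟨(hs.trans hst).le, htT.le⟩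
    have hVm : ∀ σ ∈ Ioo s t, Measurable fun x => u (max a (min (σ + a) b)) x := fun σ _ =>
      (hslice _ (hκneg σ)).measurable
    have hVN : ∀ σ ∈ Ioo s t, ∀ y, ‖u (max a (min (σ + a) b)) y‖ ≤ C / Real.sqrt (-b) :=
      fun σ hσ y => hbd σ ⟨hs.trans hσ.1, hσ.2.trans htT⟩ y
    rw [driftDuhamel_zero_eq_oseenDuhamel finrank_euclideanSpace_fin hVm hVN hst.le x]
    have hcongr : ∀ τ ∈ Ioo s t, (fun x => u (max a (min (τ + a) b)) x) = (fun σ => u (σ + a)) τ :=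
      fun τ hτ => by
        funext y
        rw [hκid τ ⟨(hs.trans hτ.1).le, (hτ.2.trans htT).le⟩]
    rw [oseenDuhamel_congr_Ioo hcongr hcongr x, oseenDuhamel_translate]
    simp only [hsid, htid]
    have h := hmild (s + a) (t + a) (by linarith) (by linarith) x
    rwa [show t + a - (s + a) = t - s by ring] at h

/-- **Joint smoothness on a window** of a continuous Type-I Oseen-mild ancient field
(KNSS 2009, Prop. 4.1 via `KNSS2009_prop41_mild_holds`, transported back along the shift
`t ↦ t - a`). [cite: KochNadirashviliSereginSverak2009, Prop. 4.1 (arXiv:0709.3599v1 p. 8)] -/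
theorem isSmoothSpaceTimeOn_window (hc : ContinuousOn (uncurry u) (Iio 0 ×ˢ univ))
    (hdiv : ∀ t < 0, IsWeaklyDivFree (u t))
    (hmild : ∀ s t : ℝ, s < t → t < 0 → ∀ x,
      u t x = UnboundedOperators.heatExtension (u s) (t - s) x - oseenDuhamel 1 s u u t x)
    (hI : HasTypeITimeDecay C u) {a b : ℝ} (hab : a < b) (hb : b < 0) :
    IsSmoothSpaceTimeOn (Ioo a b) u := by
  obtain ⟨-, -, hκid⟩ := clampShift_facts hab.le
  have hK := isKNSSDriftMild_window hc hdiv hmild hI hab hb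
  obtain ⟨ε, -, Cst, -, hP⟩ := KNSS2009_prop41_mild_holds 0
  obtain ⟨hsm, -⟩ := hP hK
  -- transport along `(t, x) ↦ (t - a, x)`
  have hmap : ContDiff ℝ ((⊤ : ℕ∞) : WithTop ℕ∞)
      fun p : ℝ × EuclideanSpace ℝ (Fin 3) => (p.1 - a, p.2) :=
    (contDiff_fst.sub contDiff_const).prodMk contDiff_snd
  have hinto : MapsTo (fun p : ℝ × EuclideanSpace ℝ (Fin 3) => (p.1 - a, p.2)) (Ioo a b ×ˢ univ)
      (Ioo 0 (b - a) ×ˢ univ) := by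
    rintro ⟨t, x⟩ ⟨ht, -⟩
    exact ⟨⟨by linarith [ht.1], by linarith [ht.2]⟩, mem_univ _⟩
  have hcomp := hsm.comp hmap.contDiffOn hinto
  refine hcomp.congr ?_
  rintro ⟨t, x⟩ ⟨ht, -⟩
  simp only [comp_apply, uncurry_apply_pair]
  rw [hκid (t - a) ⟨by linarith [ht.1], by linarith [ht.2]⟩, sub_add_cancel]

/-- **Joint smoothness on the whole open slab** `(-∞, 0) × ℝ³` of a continuous Type-I Oseen-mild
ancient field (smoothness is local; every `t < 0` lies in a window `(t - 1, t/2)`).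
[cite: KochNadirashviliSereginSverak2009, Prop. 4.1 (arXiv:0709.3599v1 p. 8)] -/
theorem contDiffOn_slab (hc : ContinuousOn (uncurry u) (Iio 0 ×ˢ univ))
    (hdiv : ∀ t < 0, IsWeaklyDivFree (u t))
    (hmild : ∀ s t : ℝ, s < t → t < 0 → ∀ x,
      u t x = UnboundedOperators.heatExtension (u s) (t - s) x - oseenDuhamel 1 s u u t x)
    (hI : HasTypeITimeDecay C u) :
    ContDiffOn ℝ (⊤ : ℕ∞) (uncurry u) (Iio 0 ×ˢ univ) := by
  refine contDiffOn_of_locally_contDiffOn ?_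
  rintro ⟨t, x⟩ ⟨ht, -⟩
  have ht' : t < 0 := ht
  refine ⟨Ioo (t - 1) (t / 2) ×ˢ univ, isOpen_Ioo.prod isOpen_univ,
    ⟨⟨by linarith, by linarith⟩, mem_univ _⟩, ?_⟩
  have h := isSmoothSpaceTimeOn_window hc hdiv hmild hI (a := t - 1) (b := t / 2)
    (by linarith) (by linarith)
  exact ContDiffOn.mono h inter_subset_right

/-- **A continuous Type-I Oseen-mild ancient field is a Type-I ancient mild solution in the
Oseen gauge** (`IsTypeIAncientMild C u`): joint smoothness by KNSS Prop. 4.1, pointwise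
divergence-freeness from weak divergence-freeness of the smooth slices
(`isDivFree_of_ae_isWeaklyDivFree_of_smooth`), the integral equation with `heatFlow = e^{(t-s)Δ}`
for `t - s > 0`. [cite: KochNadirashviliSereginSverak2009, Prop. 4.1 and §6 p. 11 (arXiv:0709.3599v1)] -/
theorem isTypeIAncientMild_of_continuous_oseenMild (hc : ContinuousOn (uncurry u) (Iio 0 ×ˢ univ))
    (hdiv : ∀ t < 0, IsWeaklyDivFree (u t))
    (hmild : ∀ s t : ℝ, s < t → t < 0 → ∀ x,
      u t x = UnboundedOperators.heatExtension (u s) (t - s) x - oseenDuhamel 1 s u u t x)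
    (hI : HasTypeITimeDecay C u) : IsTypeIAncientMild C u := by
  refine ⟨contDiffOn_slab hc hdiv hmild hI, fun t ht => ?_, fun s t hst ht x => ?_, hI⟩
  · have hsm := isSmoothSpaceTimeOn_window hc hdiv hmild hI (a := t - 1) (b := t / 2)
      (by linarith) (by linarith)
    exact isDivFree_of_ae_isWeaklyDivFree_of_smooth hsm
      ((ae_restrict_mem measurableSet_Ioo).mono fun τ hτ => hdiv τ (hτ.2.trans (by linarith)))
      ⟨by linarith, by linarith⟩
  · rw [heatFlow_of_pos _ (sub_pos.2 hst)]
    exact hmild s t hst ht x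

/-! ### Uniform bounds over the class -/

/-- **Uniform bounds for all `x`-derivatives on a window** (KNSS 2009, (4.10) via
`KNSSBootstrap.exists_norm_iteratedFDeriv_slice_le`): for `k`, a window `a < b < 0` and a margin
`δ > 0` there is `K = K(k, a, b, δ, C)` with `‖Dᵏu(t)(x)‖ ≤ K` for all `t ∈ [a + δ, b)`, all `x`,
and **all** continuous Type-I Oseen-mild ancient fields `u` with Type-I constant `C`.
[cite: KochNadirashviliSereginSverak2009, §4 (4.10) with Prop. 4.1 (4.6) (arXiv:0709.3599v1 p. 8)] -/
theorem exists_norm_iteratedFDeriv_le_of_typeI (C : ℝ) (k : ℕ) {a b δ : ℝ} (hab : a < b)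
    (hb : b < 0) (hδ : 0 < δ) :
    ∃ K : ℝ, ∀ ⦃u : ℝ → EuclideanSpace ℝ (Fin 3) → EuclideanSpace ℝ (Fin 3)⦄,
      ContinuousOn (uncurry u) (Iio 0 ×ˢ univ) →
      (∀ t < 0, IsWeaklyDivFree (u t)) →
      (∀ s t : ℝ, s < t → t < 0 → ∀ x,
        u t x = UnboundedOperators.heatExtension (u s) (t - s) x - oseenDuhamel 1 s u u t x) →
      HasTypeITimeDecay C u →
      ∀ t ∈ Ico (a + δ) b, ∀ x, ‖iteratedFDeriv ℝ k (u t) x‖ ≤ K := by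
  obtain ⟨Cf, hCf⟩ := KNSSBootstrap.exists_norm_iteratedFDeriv_slice_le
    (E := EuclideanSpace ℝ (Fin 3))
    finrank_euclideanSpace_fin (T := b - a) (N := C / Real.sqrt (-b)) k
  refine ⟨Cf δ, fun u hc hdiv hmild hI t ht x => ?_⟩
  obtain ⟨-, -, hκid⟩ := clampShift_facts hab.le
  have hK := isKNSSDriftMild_window hc hdiv hmild hI hab hb
  have h : ‖iteratedFDeriv ℝ k (fun y => u (max a (min (t - a + a) b)) y) x‖ ≤ Cf δ :=
    hCf hK δ hδ (t - a) ⟨by linarith [ht.1], by linarith [ht.2]⟩ x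
  have hV : (fun y => u (max a (min (t - a + a) b)) y) = u t := by
    funext y; rw [hκid (t - a) ⟨by linarith [ht.1], by linarith [ht.2]⟩, sub_add_cancel]
  rwa [hV] at h

/-- **Uniform time-Lipschitz bounds for all `x`-derivatives on a window** (KNSS 2009, (4.11)
via `KNSSBootstrap.exists_lipschitz_time_iteratedFDeriv`): for `k`, `a < b < 0`, `δ > 0` there
is `L = L(k, a, b, δ, C) ≥ 0` with `‖Dᵏu(t)(x) − Dᵏu(s)(x)‖ ≤ L |t − s|` for all
`s, t ∈ [a + δ, b)`, all `x`, and all continuous Type-I Oseen-mild ancient fields `u` with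
Type-I constant `C`. [cite: KochNadirashviliSereginSverak2009, §4 (4.11) (arXiv:0709.3599v1 p. 8)] -/
theorem exists_lipschitz_time_of_typeI (C : ℝ) (k : ℕ) {a b δ : ℝ} (hab : a < b) (hb : b < 0)
    (hδ : 0 < δ) :
    ∃ L : ℝ, 0 ≤ L ∧ ∀ ⦃u : ℝ → EuclideanSpace ℝ (Fin 3) → EuclideanSpace ℝ (Fin 3)⦄,
      ContinuousOn (uncurry u) (Iio 0 ×ˢ univ) →
      (∀ t < 0, IsWeaklyDivFree (u t)) →
      (∀ s t : ℝ, s < t → t < 0 → ∀ x,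
        u t x = UnboundedOperators.heatExtension (u s) (t - s) x - oseenDuhamel 1 s u u t x) →
      HasTypeITimeDecay C u →
      ∀ s ∈ Ico (a + δ) b, ∀ t ∈ Ico (a + δ) b, ∀ x,
        ‖iteratedFDeriv ℝ k (u t) x - iteratedFDeriv ℝ k (u s) x‖ ≤ L * |t - s| := by
  obtain ⟨L, hL0, hL⟩ := KNSSBootstrap.exists_lipschitz_time_iteratedFDeriv
    (E := EuclideanSpace ℝ (Fin 3))
    finrank_euclideanSpace_fin (T := b - a) (N := C / Real.sqrt (-b)) k hδ
  refine ⟨L, hL0, fun u hc hdiv hmild hI s hs t ht x => ?_⟩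
  obtain ⟨-, -, hκid⟩ := clampShift_facts hab.le
  have hK := isKNSSDriftMild_window hc hdiv hmild hI hab hb
  have h : ‖iteratedFDeriv ℝ k (fun y => u (max a (min (t - a + a) b)) y) x -
      iteratedFDeriv ℝ k (fun y => u (max a (min (s - a + a) b)) y) x‖ ≤ L * |t - a - (s - a)| :=
    hL hK (s - a) ⟨by linarith [hs.1], by linarith [hs.2]⟩ (t - a)
      ⟨by linarith [ht.1], by linarith [ht.2]⟩ x
  have hVt : (fun y => u (max a (min (t - a + a) b)) y) = u t := by
    funext y; rw [hκid (t - a) ⟨by linarith [ht.1], by linarith [ht.2]⟩, sub_add_cancel]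
  have hVs : (fun y => u (max a (min (s - a + a) b)) y) = u s := by
    funext y; rw [hκid (s - a) ⟨by linarith [hs.1], by linarith [hs.2]⟩, sub_add_cancel]
  rwa [hVt, hVs, show t - a - (s - a) = t - s by ring] at h

end Window

end Summit.NavierStokesRegularity.NavierStokesRegularity.Theorems

end
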